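import Mathlib.Geometry.Manifold.ContMDiff.NormedSpace
import Mathlib.Geometry.Manifold.ContMDiffMFDeriv
import Mathlib.Geometry.Manifold.Instances.Real
import HarnessLib

/-!
# The time derivative of a function `C¹` on `M × S` is jointly continuous

For a function `u : S × M → ℝ` on a manifold `M` times a set of times `S ⊆ ℝ`, encoded as in the
Ricci-flow layer (`RicciFlow.lean`, `IsContMDiffFamilyOn`; `RicciFlowScalarMaximumPrinciple.lean`,
`weakMaximumPrinciple`) as a map `u : ℝ → M → ℝ` with
`ContMDiffOn (I.prod 𝓘(ℝ, ℝ)) 𝓘(ℝ, ℝ) k (fun p : M × ℝ ↦ u p.2 p.1) (univ ×ˢ S)` and with time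
derivative `∂ₜu (t, x) = derivWithin (u · x) S t` (the one-sided derivative within `S`,
`hasDerivWithinAt_time`), we PROVE the regularity statement used whenever such a `u` is
differentiated under an integral sign (Topping 2006, §6.3, Prop. 6.3.1: "`v, w : M × [0, T] → ℝ`
smooth … `d/dt ∫ v w dV = ∫ (∂ₜv w + v ∂ₜw − R v w) dV`"):

* `contDiffOn_time_chart` — the chart representative `û(y, t) = u(t, φ⁻¹ y)`, `φ = extChartAt I x₀`,
  is `C^k` on `φ.target × S` in the ordinary sense;
* `derivWithin_time_eq_fderivWithin_chart` — `∂ₜu(t, x) = D û(φ x, t) · (0, 1)` for `x` in the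
  chart domain, `t ∈ S` (`k ≥ 1`, `S` with unique one-sided derivatives);
* `continuousOn_derivWithin_time` — if `k ≥ 1`, `S` has unique derivatives (e.g. an interval with
  more than one point) and the model is boundaryless, then `(x, t) ↦ ∂ₜu(t, x)` is continuous on
  `M × S`;
* `contMDiffOn_derivWithin_time_of_uniqueDiffOn` — for `k = ∞`, `(x, t) ↦ ∂ₜu(t, x)` is again
  `C^∞` on `M × S` (general time set with unique derivatives; the `[0, T]` case is
  `contMDiffOn_derivWithin_time` of `RicciFlowScalarCurvatureRegularity.lean`).

Proof: `û` is the written-in-charts form of `u` in the product chart `φ × id`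
(`contMDiffOn_iff`, `extChartAt_prod`), so its Fréchet derivative within `φ.target × S` is
continuous (`ContDiffOn.continuousOn_fderivWithin`); and `∂ₜu(t, x) = D û(φ x, t) · (0, 1)` by
the chain rule along `t ↦ (φ x, t)` and uniqueness of one-sided derivatives on `S`. Everything is
proved; no definitions, no named facts. The smoothness exponent is `k : ℕ∞` (so that the `C^k`
structure on `M × ℝ` is available from `IsManifold I ∞ M`).

## References

* P. Topping, *Lectures on the Ricci flow*, LMS Lecture Note Series 325, CUP 2006, §6.3,
  Prop. 6.3.1 (smooth `v, w : M × [0, T] → ℝ`). [Topping2006]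
-/

noncomputable section

open Set Function Filter Manifold
open scoped Manifold ContDiff Topology

namespace Literature.Geometry.Riemannian

variable {E : Type*} [NormedAddCommGroup E] [NormedSpace ℝ E]
  {H : Type*} [TopologicalSpace H] {I : ModelWithCorners ℝ E H}
  {M : Type*} [TopologicalSpace M] [ChartedSpace H M] [IsManifold I ∞ M]

/-- **The chart representative of a function `C^k` on `M × S` is `C^k` on `φ.target × S`.** For
`u` with `(x, t) ↦ u t x` of class `C^k` on `M × S` and `φ = extChartAt I x₀`, the function
`(y, t) ↦ u t (φ⁻¹ y)` is `C^k` on `φ.target ×ˢ S` in the ordinary sense (the written-in-charts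
form of `u` in the product chart `φ × id` and the identity chart of `ℝ`). [folklore] -/
theorem contDiffOn_time_chart {k : ℕ∞} {u : ℝ → M → ℝ} {S : Set ℝ}
    (hu : ContMDiffOn (I.prod 𝓘(ℝ, ℝ)) 𝓘(ℝ, ℝ) k (fun p : M × ℝ ↦ u p.2 p.1) (univ ×ˢ S))
    (x₀ : M) :
    ContDiffOn ℝ k (fun q : E × ℝ ↦ u q.2 ((extChartAt I x₀).symm q.1))
      ((extChartAt I x₀).target ×ˢ S) := by
  have h := (contMDiffOn_iff.1 hu).2 (x₀, (0 : ℝ)) (0 : ℝ)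
  refine (h.mono ?_).congr ?_
  · rintro ⟨y, s⟩ ⟨hy, hs⟩
    simp only [extChartAt_prod, mem_inter_iff, mem_preimage, mem_prod, mem_univ, true_and]
    refine ⟨⟨hy, ?_⟩, ?_, ?_⟩
    · simp
    · simpa using hs
    · simp
  · rintro ⟨y, s⟩ ⟨-, -⟩
    simp only [Function.comp_apply, extChartAt_prod, PartialEquiv.prod_symm,
      PartialEquiv.prod_coe, extChartAt_model_space_eq_id, PartialEquiv.refl_symm,
      PartialEquiv.refl_coe, id_eq]

omit [IsManifold I ∞ M] in
/-- **The time derivative in the chart.** For `u : ℝ → M → ℝ` whose chart representatives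
`û(y, t) = u t (φ⁻¹ y)` (`φ = extChartAt I x₀`) are `C^k`, `k ≥ 1`, on `φ.target ×ˢ S`, `S` with
unique derivatives, `x` in the chart domain of `x₀` and `t ∈ S`:
`∂ₜu(t, x) = D_{(φ x, t)} û · (0, 1)`, `D` the Fréchet derivative within `φ.target ×ˢ S` (chain
rule along `s ↦ (φ x, s)` and uniqueness of the derivative within `S`). [folklore] -/
theorem derivWithin_time_eq_fderivWithin_chart {k : ℕ∞} (hk : 1 ≤ k) {u : ℝ → M → ℝ}
    {S : Set ℝ} (hS : UniqueDiffOn ℝ S) (x₀ : M)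
    (hû : ContDiffOn ℝ k (fun q : E × ℝ ↦ u q.2 ((extChartAt I x₀).symm q.1))
      ((extChartAt I x₀).target ×ˢ S))
    {x : M} (hx : x ∈ (extChartAt I x₀).source) {t : ℝ} (ht : t ∈ S) :
    derivWithin (fun s ↦ u s x) S t =
      fderivWithin ℝ (fun q : E × ℝ ↦ u q.2 ((extChartAt I x₀).symm q.1))
        ((extChartAt I x₀).target ×ˢ S) (extChartAt I x₀ x, t) (0, 1) := by
  set φ := extChartAt I x₀ with hφ
  set û : E × ℝ → ℝ := fun q ↦ u q.2 (φ.symm q.1) with hû_def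
  have hk0 : (k : ℕ∞ω) ≠ 0 := by
    have : k ≠ 0 := Order.one_le_iff_ne_zero.1 hk
    exact_mod_cast this
  have hyT : φ x ∈ φ.target := φ.map_source hx
  have hdiff : DifferentiableWithinAt ℝ û (φ.target ×ˢ S) (φ x, t) :=
    (hû (φ x, t) ⟨hyT, ht⟩).differentiableWithinAt hk0
  -- the curve `s ↦ (φ x, s)` within `S`
  have hι : HasDerivWithinAt (fun s : ℝ ↦ (φ x, s)) ((0 : E), (1 : ℝ)) S t :=
    (hasDerivWithinAt_const t S (φ x)).prodMk (hasDerivWithinAt_id t S)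
  have hmaps : MapsTo (fun s : ℝ ↦ (φ x, s)) S (φ.target ×ˢ S) := fun s hs ↦ ⟨hyT, hs⟩
  have hcomp : HasDerivWithinAt (û ∘ fun s : ℝ ↦ (φ x, s))
      (fderivWithin ℝ û (φ.target ×ˢ S) (φ x, t) ((0 : E), (1 : ℝ))) S t :=
    hdiff.hasFDerivWithinAt.comp_hasDerivWithinAt t hι hmaps
  have heq : (û ∘ fun s : ℝ ↦ (φ x, s)) = fun s ↦ u s x := by
    funext s
    simp [hû_def, φ.left_inv hx]
  rw [heq] at hcomp
  exact hcomp.derivWithin (hS t ht)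

variable [I.Boundaryless]

/-- **The time derivative of a function `C¹` on `M × S` is jointly continuous.** Let `M` be a
`C^∞` manifold on a boundaryless model, `S ⊆ ℝ` a set of times with unique derivatives (e.g. an
interval with more than one point), and `u : ℝ → M → ℝ` with `(x, t) ↦ u t x` of class `C^k`,
`1 ≤ k ≤ ∞`, on `M × S` (the encoding of "`u : M × [0, T] → ℝ` smooth" of the Ricci-flow layer).
Then the one-sided time derivative `(x, t) ↦ ∂ₜu(t, x) = derivWithin (u · x) S t` is continuous
on `M × S`. (The regularity behind "we may calculate `d/dt ∫ v w dV = ∫ (∂ₜv w + v ∂ₜw − Rvw) dV`"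
for smooth `v, w : M × [0, T] → ℝ`, Topping 2006, proof of Prop. 6.3.1.)
[cite: Topping2006, §6.3, Prop. 6.3.1 (proof)] -/
theorem continuousOn_derivWithin_time {k : ℕ∞} (hk : 1 ≤ k) {u : ℝ → M → ℝ} {S : Set ℝ}
    (hS : UniqueDiffOn ℝ S)
    (hu : ContMDiffOn (I.prod 𝓘(ℝ, ℝ)) 𝓘(ℝ, ℝ) k (fun p : M × ℝ ↦ u p.2 p.1) (univ ×ˢ S)) :
    ContinuousOn (fun z : M × ℝ ↦ derivWithin (fun s ↦ u s z.1) S z.2) (univ ×ˢ S) := by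
  have hk1 : (1 : ℕ∞ω) ≤ (k : ℕ∞ω) := by exact_mod_cast hk
  rintro ⟨x₀, t₀⟩ ⟨-, ht₀⟩
  set φ := extChartAt I x₀ with hφ
  set û : E × ℝ → ℝ := fun q ↦ u q.2 (φ.symm q.1) with hû_def
  have hû : ContDiffOn ℝ k û (φ.target ×ˢ S) := contDiffOn_time_chart hu x₀
  have hT : UniqueDiffOn ℝ (φ.target ×ˢ S) :=
    (isOpen_extChartAt_target x₀).uniqueDiffOn.prod hS
  -- the Fréchet derivative of the representative is continuous on `φ.target × S`
  have hDc : ContinuousOn (fun q ↦ fderivWithin ℝ û (φ.target ×ˢ S) q) (φ.target ×ˢ S) :=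
    hû.continuousOn_fderivWithin hT hk1
  -- hence so is `(x, t) ↦ D û (φ x, t) (0, 1)` on `φ.source × S`
  have hψ : ContinuousOn (fun z : M × ℝ ↦ (φ z.1, z.2)) (φ.source ×ˢ S) :=
    ((continuousOn_extChartAt x₀).comp continuous_fst.continuousOn fun z hz ↦ hz.1).prodMk
      continuous_snd.continuousOn
  have hmaps : MapsTo (fun z : M × ℝ ↦ (φ z.1, z.2)) (φ.source ×ˢ S) (φ.target ×ˢ S) :=
    fun z hz ↦ ⟨φ.map_source hz.1, hz.2⟩
  have hcomp : ContinuousOn (fun z : M × ℝ ↦ fderivWithin ℝ û (φ.target ×ˢ S) (φ z.1, z.2)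
      ((0 : E), (1 : ℝ))) (φ.source ×ˢ S) :=
    ((ContinuousLinearMap.apply ℝ ℝ ((0 : E), (1 : ℝ))).continuous.comp_continuousOn
      (hDc.comp hψ hmaps) :)
  -- which agrees with the time derivative there
  have hagree : ∀ z ∈ φ.source ×ˢ S, derivWithin (fun s ↦ u s z.1) S z.2 =
      fderivWithin ℝ û (φ.target ×ˢ S) (φ z.1, z.2) ((0 : E), (1 : ℝ)) := fun z hz ↦
    derivWithin_time_eq_fderivWithin_chart hk hS x₀ hû hz.1 hz.2
  have hloc : ContinuousOn (fun z : M × ℝ ↦ derivWithin (fun s ↦ u s z.1) S z.2)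
      (φ.source ×ˢ S) :=
    hcomp.congr hagree
  -- `φ.source × S` is a neighbourhood of `(x₀, t₀)` within `M × S`
  have hmem : (x₀, t₀) ∈ φ.source ×ˢ S := ⟨mem_extChartAt_source x₀, ht₀⟩
  have hnhds : φ.source ×ˢ S ∈ 𝓝[univ ×ˢ S] (x₀, t₀) := by
    have h1 : φ.source ×ˢ (univ : Set ℝ) ∈ 𝓝 (x₀, t₀) :=
      prod_mem_nhds (extChartAt_source_mem_nhds x₀) univ_mem
    have h2 : φ.source ×ˢ S = (univ ×ˢ S) ∩ (φ.source ×ˢ (univ : Set ℝ)) := by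
      ext z; simp only [mem_prod, mem_univ, true_and, and_true, mem_inter_iff]; tauto
    rw [h2]
    exact inter_mem_nhdsWithin _ h1
  exact (hloc.continuousWithinAt hmem).mono_of_mem_nhdsWithin hnhds

/-- **The time derivative of a function `C^∞` on `M × S` is `C^∞` on `M × S`**, for any time set
`S` with unique derivatives (smooth upgrade of `continuousOn_derivWithin_time`, same chart
argument; the case `S = [0, T]` is `contMDiffOn_derivWithin_time`,
`RicciFlowScalarCurvatureRegularity.lean`: in the chart `φ` at `x₀` the representative
`û` is `C^∞` on `φ.target ×ˢ S`, so is its Fréchet derivative within that set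
(`ContDiffOn.fderivWithin`), and `∂ₜu(t, x) = D û(φ x, t) · (0, 1)`). This is the regularity of
`∂ₜv`, `∂ₜg`, … used when the sources differentiate smooth space-time quantities repeatedly
(Topping 2006, §2.5 and §6.3: evolution equations of `dV`, `R`, `∫ v w dV` for smooth families).
[cite: Topping2006, §6.3, Prop. 6.3.1 (proof)] -/
theorem contMDiffOn_derivWithin_time_of_uniqueDiffOn {u : ℝ → M → ℝ} {S : Set ℝ}
    (hS : UniqueDiffOn ℝ S)
    (hu : ContMDiffOn (I.prod 𝓘(ℝ, ℝ)) 𝓘(ℝ, ℝ) ∞ (fun p : M × ℝ ↦ u p.2 p.1) (univ ×ˢ S)) :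
    ContMDiffOn (I.prod 𝓘(ℝ, ℝ)) 𝓘(ℝ, ℝ) ∞
      (fun z : M × ℝ ↦ derivWithin (fun s ↦ u s z.1) S z.2) (univ ×ˢ S) := by
  rintro ⟨x₀, t₀⟩ ⟨-, ht₀⟩
  set φ := extChartAt I x₀ with hφ
  set û : E × ℝ → ℝ := fun q ↦ u q.2 (φ.symm q.1) with hû_def
  have hû : ContDiffOn ℝ ∞ û (φ.target ×ˢ S) := contDiffOn_time_chart (k := (⊤ : ℕ∞)) hu x₀
  have hT : UniqueDiffOn ℝ (φ.target ×ˢ S) :=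
    (isOpen_extChartAt_target x₀).uniqueDiffOn.prod hS
  -- the Fréchet derivative of the representative is `C^∞` on `φ.target × S`
  have hD : ContDiffOn ℝ ∞ (fun q ↦ fderivWithin ℝ û (φ.target ×ˢ S) q ((0 : E), (1 : ℝ)))
      (φ.target ×ˢ S) :=
    (hû.fderivWithin hT (by norm_cast)).clm_apply contDiffOn_const
  -- the map `(x, t) ↦ (φ x, t)` is `C^∞` on `φ.source × S` into `E × ℝ`
  have hψ : ContMDiffOn (I.prod 𝓘(ℝ, ℝ)) 𝓘(ℝ, E × ℝ) ∞ (fun z : M × ℝ ↦ (φ z.1, z.2))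
      (φ.source ×ˢ S) := by
    intro z hz
    have h1 : ContMDiffWithinAt (I.prod 𝓘(ℝ, ℝ)) 𝓘(ℝ, E) ∞ (fun z : M × ℝ ↦ φ z.1)
        (φ.source ×ˢ S) z := by
      have hsrc : z.1 ∈ (chartAt H x₀).source := by
        simpa only [hφ, extChartAt_source] using hz.1
      exact ((contMDiffOn_extChartAt (I := I) (n := ∞) (x := x₀)) z.1 hsrc).comp z
        contMDiffWithinAt_fst (fun w hw ↦ by simpa only [hφ, extChartAt_source] using hw.1)
    exact h1.prodMk_space contMDiffWithinAt_snd
  have hmaps : (φ.source ×ˢ S) ⊆ (fun z : M × ℝ ↦ (φ z.1, z.2)) ⁻¹' (φ.target ×ˢ S) :=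
    fun z hz ↦ ⟨φ.map_source hz.1, hz.2⟩
  -- hence `(x, t) ↦ D û (φ x, t) (0, 1)` is `C^∞` on `φ.source × S`
  have hmem : (x₀, t₀) ∈ φ.source ×ˢ S := ⟨mem_extChartAt_source x₀, ht₀⟩
  have hcomp : ContMDiffWithinAt (I.prod 𝓘(ℝ, ℝ)) 𝓘(ℝ, ℝ) ∞
      ((fun q ↦ fderivWithin ℝ û (φ.target ×ˢ S) q ((0 : E), (1 : ℝ))) ∘
        fun z : M × ℝ ↦ (φ z.1, z.2)) (φ.source ×ˢ S) (x₀, t₀) :=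
    ContDiffWithinAt.comp_contMDiffWithinAt (f := fun z : M × ℝ ↦ (φ z.1, z.2)) (x := (x₀, t₀))
      (hD _ (hmaps hmem)) (hψ _ hmem) hmaps
  -- which agrees with the time derivative there
  have hagree : ∀ z ∈ φ.source ×ˢ S, derivWithin (fun s ↦ u s z.1) S z.2 =
      ((fun q ↦ fderivWithin ℝ û (φ.target ×ˢ S) q ((0 : E), (1 : ℝ))) ∘
        fun z : M × ℝ ↦ (φ z.1, z.2)) z := fun z hz ↦
    derivWithin_time_eq_fderivWithin_chart (k := (⊤ : ℕ∞)) le_top hS x₀ hû hz.1 hz.2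
  have hloc : ContMDiffWithinAt (I.prod 𝓘(ℝ, ℝ)) 𝓘(ℝ, ℝ) ∞
      (fun z : M × ℝ ↦ derivWithin (fun s ↦ u s z.1) S z.2) (φ.source ×ˢ S) (x₀, t₀) :=
    hcomp.congr (fun z hz ↦ hagree z hz) (hagree _ hmem)
  -- `φ.source × S` is a neighbourhood of `(x₀, t₀)` within `M × S`
  have hnhds : φ.source ×ˢ S ∈ 𝓝[univ ×ˢ S] (x₀, t₀) := by
    have h1 : φ.source ×ˢ (univ : Set ℝ) ∈ 𝓝 (x₀, t₀) :=
      prod_mem_nhds (extChartAt_source_mem_nhds x₀) univ_mem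
    have h2 : φ.source ×ˢ S = (univ ×ˢ S) ∩ (φ.source ×ˢ (univ : Set ℝ)) := by
      ext z; simp only [mem_prod, mem_univ, true_and, and_true, mem_inter_iff]; tauto
    rw [h2]
    exact inter_mem_nhdsWithin _ h1
  exact hloc.mono_of_mem_nhdsWithin hnhds

end Literature.Geometry.Riemannian

end
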